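import Literature.AlgebraicGeometry.Dimension.FibreLocalRingDimension
import HarnessLib

/-!
# Dimension guard: a closed set whose components have generic codimension ≥ c has dimension ≤ dim − c

Topic: `Literature/AlgebraicGeometry/Resolution` (dimension bookkeeping).  TOOL (decomp-res lens-6 g30; second brick for the g31
frame «SurfCut» of the F-surf-sing door, next to the «solid clause» `MarkedIdealsCodimOneSupport`): the Cossart–Jannsen–Saito
surface phase must be fed a closed subset of dimension `≤ 2` of the regular fourfold; after the codimension-one components of the
bad locus are split off (solid clause: they are regular and isolated), what is left has all its components of generic codimension
`≥ 2`, hence dimension `≤ 4 − 2`.  PROVED here, for a scheme `Y` (Mathlib's specialisation preorder on its points, `x ≤ y ↔ y ⤳ x`):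

* `height_le_height_of_specializes` — `ξ ⤳ x ⇒ height x ≤ height ξ` (points of `cl{ξ}` have smaller closures);
* `height_le_sub_of_le_coheight` — `dim Y ≤ d` and `c ≤ coheight ξ` give `height ξ ≤ d − c`
  (`height + coheight ≤ dim`, `Literature.AlgebraicGeometry.Dimension.height_add_coheight_le_topologicalKrullDim`);
* `topologicalKrullDim_coe_le_of_forall_height_le` — **a CLOSED subset `B ⊆ Y` all of whose points have `height ≤ n` has
  `topologicalKrullDim B ≤ n`** (a chain of irreducible closed subsets of `B` is a chain of irreducible closed subsets of `Y` below
  the generic point of its top member, which lies in `B`; Mathlib `irreducibleSetEquivPoints`, `Order.length_le_height_last`);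
* `topologicalKrullDim_coe_le_of_forall_exists_specializes` — **the guard**: if `dim Y ≤ d` and every point of the closed set `B`
  is a specialisation of a point of `B` of coheight `≥ c` (every irreducible component of `B` has generic codimension `≥ c`), then
  `topologicalKrullDim B ≤ d − c`.

## Sources
* A. Grothendieck, EGA IV₁ (Publ. IHÉS 20, 1964), §0.14.1–14.2 (dimension and codimension of closed subsets, `dim Z + codim(Z, X) ≤ dim X`). [EGAIV1]
* The Stacks Project, Tags 0055 (Krull dimension of sober spaces via specialisation chains), 02I4 (codimension). [StacksProject]
[new; elementary] [folklore]

[WRITER NOTE (decomp-res writer g14): rider letter row 222c item (7) named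
`Literature/AlgebraicGeometry/Resolution/DimensionGuard.lean`; the gate's lint `literature-cited-only` sends uncited
new statements to `Summits/…`, and the family is kept together, so this file lands VERBATIM as
`Summits/ResolutionOfSingularities/ResolutionOfSingularities/Theorems/DimensionGuard.lean` — module
`Summits.ResolutionOfSingularities.ResolutionOfSingularities.Theorems.DimensionGuard`; namespace and declarations
unchanged; bib key `EGAIV1` added to references.bib for the `[cite: EGAIV1, §0.14.2]` tags.]
-/

noncomputable section

open CategoryTheory AlgebraicGeometry TopologicalSpace Topology Order

namespace Literature.AlgebraicGeometry.Resolution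

universe u

variable {Y : Scheme.{u}}

section DimensionGuard

/-- `ξ ⤳ x ⇒ height x ≤ height ξ` (in the specialisation preorder `x ≤ ξ`). [folklore] -/
theorem height_le_height_of_specializes {ξ x : Y} (h : ξ ⤳ x) : height x ≤ height ξ :=
  height_mono (show x ≤ ξ from h)

/-- **`dim Y ≤ d`, `c ≤ codim ξ` ⇒ `height ξ ≤ d − c`** (`height ξ + coheight ξ ≤ dim Y`). [cite: EGAIV1, §0.14.2] -/
theorem height_le_sub_of_le_coheight {d c : ℕ} (hY : topologicalKrullDim Y ≤ d) {ξ : Y}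
    (hc : (c : ℕ∞) ≤ coheight ξ) : height ξ ≤ ((d - c : ℕ) : ℕ∞) := by
  have h1 := (Literature.AlgebraicGeometry.Dimension.height_add_coheight_le_topologicalKrullDim ξ).trans hY
  have h2 : height ξ + coheight ξ ≤ (d : ℕ∞) := by exact_mod_cast h1
  -- `height ξ` is finite
  cases hh : height ξ with
  | top =>
    exfalso
    rw [hh, top_add] at h2
    exact (ENat.coe_ne_top d) (top_le_iff.mp h2)
  | coe m =>
    rw [hh] at h2
    cases hk : coheight ξ with
    | top =>
      exfalso
      rw [hk, add_top] at h2
      exact (ENat.coe_ne_top d) (top_le_iff.mp h2)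
    | coe k =>
      rw [hk] at h2 hc
      have h3 : m + k ≤ d := by exact_mod_cast h2
      have h4 : c ≤ k := by exact_mod_cast hc
      exact_mod_cast (show m ≤ d - c by omega)

/-- **A closed subset all of whose points have height `≤ n` has dimension `≤ n`.**  A strictly increasing chain of irreducible
closed subsets of `B` is (taking images in `Y`) a chain of irreducible closed subsets of `Y` inside `B`; under Mathlib's
`irreducibleSetEquivPoints` it is a chain of points of `Y` below the generic point of the top member, which lies in `B`, so its
length is at most that point's height. [cite: StacksProject, Tag 0055] -/
theorem topologicalKrullDim_coe_le_of_forall_height_le {B : Set Y} (hB : IsClosed B) (n : ℕ)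
    (h : ∀ x ∈ B, height x ≤ n) : topologicalKrullDim B ≤ n := by
  -- the image map on irreducible closed subsets
  have hemb : IsClosedEmbedding (Subtype.val : B → Y) := hB.isClosedEmbedding_subtypeVal
  let φ : IrreducibleCloseds B → IrreducibleCloseds Y := fun T =>
    ⟨Subtype.val '' (T : Set B), T.2.image _ continuous_subtype_val.continuousOn, hemb.isClosedMap _ T.3⟩
  have hφc : ∀ T : IrreducibleCloseds B, (φ T : Set Y) = Subtype.val '' (T : Set B) := fun T => rfl
  have hφ : StrictMono φ := by
    intro S T hST
    have hle : (φ S : Set Y) ⊆ φ T := by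
      rw [hφc, hφc]; exact Set.image_mono (SetLike.coe_subset_coe.mpr hST.le)
    have hne : φ S ≠ φ T := by
      intro hEq
      have h1 : Subtype.val '' (S : Set B) = Subtype.val '' (T : Set B) := by
        rw [← hφc, ← hφc, hEq]
      exact hST.ne (SetLike.coe_injective (Subtype.val_injective.image_injective h1))
    exact lt_of_le_of_ne (SetLike.coe_subset_coe.mp hle) hne
  rw [topologicalKrullDim, Order.krullDim]
  refine iSup_le fun p => ?_
  -- transport the chain to points of `Y`
  let q : LTSeries (IrreducibleCloseds Y) := p.map φ hφ
  let e := irreducibleSetEquivPoints (α := Y)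
  let r : LTSeries Y := q.map e e.strictMono
  have hlen : r.length = p.length := by simp [r, q]
  -- the last point lies in `B`
  have hlast : r.last ∈ B := by
    have hr : r.last = e q.last := LTSeries.last_map q e e.strictMono
    have hq : q.last = φ p.last := LTSeries.last_map p φ hφ
    have hgen : IsGenericPoint (e q.last) (closure ((q.last : IrreducibleCloseds Y) : Set Y)) :=
      q.last.2.isGenericPoint_genericPoint_closure
    have hmem : e q.last ∈ ((q.last : IrreducibleCloseds Y) : Set Y) := by
      have := hgen.mem
      rwa [q.last.isClosed.closure_eq] at this
    have hmem' : e q.last ∈ Subtype.val '' ((p.last : IrreducibleCloseds B) : Set B) := by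
      rw [← hφc, ← hq]; exact hmem
    obtain ⟨b, -, hb⟩ := hmem'
    rw [hr, ← hb]
    exact b.2
  have h1 : (p.length : ℕ∞) ≤ height r.last := by
    rw [← hlen]
    exact Order.length_le_height_last
  have h2 := h1.trans (h _ hlast)
  have h3 : p.length ≤ n := by exact_mod_cast h2
  exact_mod_cast h3

/-- **The dimension guard.**  If `dim Y ≤ d` and every point of the closed set `B` is a specialisation of a point of `B` of
codimension at least `c` (equivalently: every irreducible component of `B` has generic codimension `≥ c`), then
`topologicalKrullDim B ≤ d − c`.  Use: `d = 4`, `c = 2` — the bad locus of a datum on a regular fourfold, minus its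
(regular, isolated) three-dimensional components, is fed to the surface phase. [cite: EGAIV1, §0.14.2] -/
theorem topologicalKrullDim_coe_le_of_forall_exists_specializes {d c : ℕ} (hY : topologicalKrullDim Y ≤ d) {B : Set Y}
    (hB : IsClosed B) (h : ∀ x ∈ B, ∃ ξ ∈ B, ξ ⤳ x ∧ (c : ℕ∞) ≤ coheight ξ) :
    topologicalKrullDim B ≤ ((d - c : ℕ) : WithBot ℕ∞) := by
  refine topologicalKrullDim_coe_le_of_forall_height_le hB (d - c) fun x hx => ?_
  obtain ⟨ξ, -, hξx, hc⟩ := h x hx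
  exact (height_le_height_of_specializes hξx).trans (height_le_sub_of_le_coheight hY hc)

end DimensionGuard

end Literature.AlgebraicGeometry.Resolution

end
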